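import Mathlib
import Literature.Analysis.Complex.HolomorphicTaylorApprox
import Literature.MathematicalPhysics.QuantumFieldTheory.Balaban1983to89.B10

/-!
# `Balaban1983to89.B10SectAGathering` — [Balaban1985UV3] Sect. A (22)–(37) pp. 261–265 and Sect. C (55)–(62)
# pp. 269–272: the sixth-order expansions (30)/(60) with their remainder made explicit, the ε-power counting of the
# remainders uniformly in the step k, and the two "gathering together" sentences (p. 265 ⇒ (36)–(37); p. 271–272 ⇒
# (41)–(47) at k + 1) as kernel-checked exponent bookkeeping over named leaves

T. Bałaban, *Ultraviolet stability of three-dimensional lattice pure gauge field theories*, Commun. Math. Phys. **102**,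
255–275 (1985) [Balaban1985UV3] (cell paper B10; PDF `paper:balaban1985-cmp102-uv-stability-3d`, journal page = PDF
page + 254).  Sibling of `…Balaban1983to89.B10` (the typed skeleton of the paper), which it imports and leaves
untouched.  There, Theorem 2 is derived from three leaves (`B10.thm2_of_sections`): (1) at k = 0 (`Step0Printed`), the
WHOLE of Sect. A as one leaf (`FirstStep36_37Printed` = (36)–(37) = (41), (47) at k = 1) and the WHOLE of Sect. C as one
leaf (`SectCStepPrinted` = (41)_k ∧ (47)_k ⇒ (41)_{k+1} ∧ (47)_{k+1}).  This module resolves both one-leaf sections ONE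
LEVEL DOWN, to the displayed formulas and located sentences of the printed proof:

* `norm_sub_taylorPolynomial_le` — the quantitative Taylor remainder of order N for a holomorphic map on a ball of a
  finite-dimensional complex normed space (the kernel core of the three "up to the sixth order" expansions: (30)
  p. 263, p. 269 *"We expand the functions in the last exponential above up to the sixth order in g_k, and we estimate
  the remainder"*, p. 271 ⇒ (60)), from the support library `Literature.Analysis.Complex.HolomorphicTaylorApprox`
  (Cauchy estimate `norm_taylorCoeff_le` + `hasSum_taylorCoeff`; the N-independent geometric-tail form below is the
  one the paper uses and is not exported there);
* `taylor7_remainder_le`, `remainder30_le` — (30) with the bound (28) inserted: the printed `O(g₀⁷)e^{−κ𝓛(X)}` with its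
  constant EXPLICIT — it carries `(r(g₀)p(g₀))⁷ = b₀⁷(1 + log g₀⁻¹)^{7(r₀+p₀)}` and the seventh power of the inverse
  ANALYTICITY RADIUS ρ of `𝓗 ↦ 𝒫′₁(g₀, X, exp i𝓗)`, which the paper takes from *"the results of previous papers"*
  (p. 263) without a value (cell GAPS G-B10-04: the located gap is the hypotheses `hΦ`/`hMX` below, not the calculus);
* `gRun_pow7_logpow_le`, `remainder_powerCounting` — the ε-power counting behind p. 262 *"O(g₀⁷p¹⁸(g₀))|Ω₁| ≤
  O(ε^{3+κ₀})|T₁|, κ₀ > 0"* and p. 269 *"O(g⁷p¹⁸(g_k))|B(Λ_{k+1})| ≤ O((L^kε)^{3+κ₀})|T₁^{(k)}|"*: with g_k = g(L^kε)^{1/2},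
  `g_k⁷(1 + log g_k⁻¹)^q ≤ g^{6+2κ₀}(q/(1−2κ₀))^q e^{1−2κ₀−q}·(L^kε)^{3+κ₀}` for every q > 0 and κ₀ < ½ — the constant
  depends on g, q, κ₀ only, NOT on k or ε (the uniformity Theorem 1 needs and the print does not display; cell GAPS
  C-adv9-29 (d), C-adv9-32 (d)); the admissible window is exactly 0 < κ₀ < ½;
* `StepPieces` / the leaves `Bound55` … `RmSucc` / `ineq41_succ_of_leaves`, `ineq47_succ_of_leaves` — ONE renormalization
  step k → k + 1 (k = 0 is Sect. A, k ≥ 1 is Sect. C: p. 267 *"Now we do the same operations as in the first step"*)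
  as exponent bookkeeping: the per-history bound (22)/(55)+(58), the cluster expansion (24)/(58)–(59), the
  representation (33)/(60), the whole-lattice vacuum sum (p. 265 *"This sum can be bounded by O(g₀)|Ω₁ᶜ|"* / p. 270
  *"estimated by O(g_k)|Z_k|"*), the normalisation (35) and the decomposition of `log Z(·, U) − log Z(·, 1)` (p. 265 /
  (61)), the complement of the constants *"involving log σ₀ and log g₀, to the whole lattice"* (p. 265 / p. 271), the
  old interaction terms with `Y_j ⊄ Ω_{k+1}` (p. 272), and the definitions E^{(k)} (36)/(62), E_{k+1} = E_k − E^{(k)} —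
  each a typed leaf quoting the printed sentence, the UNPRINTED counts among them flagged (cell GAPS G-B10-07) — imply
  `B10.Ineq41 T k → B10.Ineq41 T (k+1)` and `B10.Ineq47 T k → B10.Ineq47 T (k+1)` with the O(log g_k⁻¹)|Z_k| and
  O((L^kε)^{3+κ₀})|T₁^{(k)}| constants of (41) COMPUTED from the leaves' constants (`ZtermSucc`/`RmSucc` say how large
  the printed O(·) must be taken); `firstStep36_37_of_leaves`, `sectCStep_of_leaves`, `thm2_of_leaves` re-assemble
  `B10.FirstStep36_37Printed`, `B10.SectCStepPrinted`, `B10.Thm2Printed`.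

CITATION HEADER (lean-in-tree rule 2026-08-18).  WHAT IS REPRODUCED: the displayed formulas (22), (24), (28), (30),
(33), (35), (36), (37), (55), (58), (60), (61), (62) and the sentences of pp. 262, 263, 264, 265, 269, 270, 271, 272 quoted
«…» in the docstrings, read on the page renders `pub-balaban/b2b-balaban-ref1/pages/1985-cmp102-uv-stability-3d/`
(p007–p012, p015–p018) as images.  NOTHING of the series is asserted: every leaf is a `def … : Prop` used downstream
only as a hypothesis; every `theorem` is real/complex analysis ([folklore]) or a re-derivation of a printed
bookkeeping step from the typed leaves (its docstring says which).  d = 3 THROUGHOUT (g_k = g(L^kε)^{1/2} → 0 as ε → 0 is what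
`remainder_powerCounting` uses; in the d = 4 papers under audit neither this nor the irrelevance (46) is available —
cell DIVERGENCE D-r2.1).  Value = kernel certificate of
the printed calculus and bookkeeping + located leaves, NOT summit progress.  Unit `b2b-balaban-b10-g6` (PAPER SUB-CELL
B10 gen 6); cell records GAPS C-b10g6-1 / G-B10-13, DIVERGENCE D-b10.10.
-/

noncomputable section

open scoped Topology Nat
open Metric Set

namespace Literature.MathematicalPhysics.QuantumFieldTheory.Balaban1983to89.B10SectAGathering

open Literature.MathematicalPhysics.QuantumFieldTheory.Balaban1983to89.B10
open Literature.Analysis.Complex (taylorPolynomial)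

/-! ## 1. The Taylor remainder of order N on a ball (the calculus behind "up to the sixth order") -/

section TaylorRemainder

variable {E : Type*} [NormedAddCommGroup E] [NormedSpace ℂ E] [FiniteDimensional ℂ E]
  {F : Type*} [NormedAddCommGroup F] [NormedSpace ℂ F] [CompleteSpace F]

/-- **Taylor remainder of order `N` from a sup bound, several variables** (Hörmander (1973), Thms. 2.2.6–2.2.7 made
quantitative): for `h` holomorphic on `ball c R` in a finite-dimensional complex normed space, `0 < s < R' < R`,
`‖h‖ ≤ M` on `closedBall c R'` and `y ∈ closedBall c s`,
`‖h y − Σ_{n<N} (n!)⁻¹ Dⁿh(c)(y−c,…,y−c)‖ ≤ M (s/R')^N / (1 − s/R')` — the tail of the Taylor series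
(`Literature.Analysis.Complex.hasSum_taylorCoeff`) dominated through Cauchy's inequality
(`Literature.Analysis.Complex.norm_taylorCoeff_le`) by the geometric series of ratio `s/R' < 1`.  This is the estimate
behind every *"we expand … up to the sixth order … and we estimate the remainder"* of [Balaban1985UV3] ((30) p. 263,
p. 269, (60) p. 271): a remainder of relative size (‖argument‖/radius)^{N}. [folklore] -/
theorem norm_sub_taylorPolynomial_le {h : E → F} {c : E} {R R' s M : ℝ}
    (hh : DifferentiableOn ℂ h (ball c R)) (hs : 0 < s) (hsR' : s < R') (hR'R : R' < R)
    (hM : ∀ z ∈ closedBall c R', ‖h z‖ ≤ M) {y : E} (hy : y ∈ closedBall c s) (N : ℕ) :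
    ‖h y - taylorPolynomial h c N y‖ ≤ M * (s / R') ^ N / (1 - s / R') := by
  have hR'0 : 0 < R' := hs.trans hsR'
  set q : ℝ := s / R' with hq
  have hq0 : 0 ≤ q := div_nonneg hs.le hR'0.le
  have hq1 : q < 1 := (div_lt_one hR'0).2 hsR'
  have hsum := Literature.Analysis.Complex.hasSum_taylorCoeff hh
    (closedBall_subset_ball (hsR'.trans hR'R) hy)
  have htail : HasSum (fun n => ((n + N) ! : ℂ)⁻¹ • iteratedFDeriv ℂ (n + N) h c fun _ => y - c)
      (h y - taylorPolynomial h c N y) :=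
    (hasSum_nat_add_iff' N).2 hsum
  have hbd : ∀ n, ‖((n + N) ! : ℂ)⁻¹ • iteratedFDeriv ℂ (n + N) h c (fun _ => y - c)‖ ≤
      M * q ^ N * q ^ n := by
    intro n
    have h1 := Literature.Analysis.Complex.norm_taylorCoeff_le hh hs hsR' hR'R hM hy (n + N)
    have h2 : M / (R' / s) ^ (n + N) = M * q ^ N * q ^ n := by
      rw [div_eq_mul_inv M, ← inv_pow, inv_div, ← hq, pow_add]
      ring
    rw [h2] at h1
    exact h1
  have hgsum : HasSum (fun n : ℕ => M * q ^ N * q ^ n) (M * q ^ N * (1 - q)⁻¹) :=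
    (hasSum_geometric_of_lt_one hq0 hq1).mul_left _
  have := htail.norm_le_of_bounded hgsum hbd
  simpa [div_eq_mul_inv] using this

/-- **(30)** p. 263 [9] with **(28)** inserted, abstract form.  Printed: «By the gauge invariance (26), we have (29)
𝒫′₁(g₀, X, U₁) = 𝒫′₁(g₀, X, exp i𝓗(B)), and we expand the function with respect to 𝓗(B). Because of the bound (28) it
is enough to expand up to the sixth order, hence (30) 𝒫′₁(g₀, X, exp i𝓗(B)) = 𝒫′₁(g₀, X, 1) + ⟨(δ/δ𝓗 𝒫′₁)(g₀, X, 1),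
𝓗(B)⟩ + Σ_{n=2}^{6} (1/n!)⟨(δⁿ/δ𝓗ⁿ 𝒫′₁)(g₀, X, 1), ⊗ⁿ𝓗(B)⟩ + O(g₀⁷)e^{−κ𝓛(X)}.»; p. 263: «The third property is the
analyticity with respect to U₁. These properties follow from the results of previous papers»; (25) p. 262 [8]:
«|𝒫′₁(g₀, X, U₁)| ≤ O(g₀)e^{−κ𝓛(X)}».  Typed over a finite-dimensional complex normed space `E` of configurations 𝓗
(the lattice is finite): IF `Φ := 𝓗 ↦ 𝒫′₁(g₀, X, exp i𝓗)` is holomorphic on `ball 0 ρ` and bounded by `MX` on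
`closedBall 0 (ρ/2)` (the two hypotheses the paper imports from [7] Sect. F / [9], [10] without stating ρ — cell GAPS
G-B10-04), and `‖𝓗‖ ≤ s ≤ ρ/4`, THEN the sixth-order Taylor polynomial (the displayed terms n = 0, …, 6 of (30),
`taylorPolynomial Φ 0 7`) approximates `Φ 𝓗` within `2·MX·(2s/ρ)⁷`.  Re-derived (the calculus of (30)); the
analyticity and the bound are hypotheses. [cite: Balaban1985UV3, (30) p.263] -/
theorem taylor7_remainder_le {Φ : E → F} {ρ MX s : ℝ} (hρ : 0 < ρ)
    (hΦ : DifferentiableOn ℂ Φ (ball 0 ρ)) (hMX : ∀ z ∈ closedBall (0 : E) (ρ / 2), ‖Φ z‖ ≤ MX)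
    (hs : 0 < s) (hsρ : s ≤ ρ / 4) {𝓗 : E} (h𝓗 : ‖𝓗‖ ≤ s) :
    ‖Φ 𝓗 - taylorPolynomial Φ 0 7 𝓗‖ ≤ 2 * MX * (2 * s / ρ) ^ 7 := by
  have hy : 𝓗 ∈ closedBall (0 : E) s := by simpa using h𝓗
  have h := norm_sub_taylorPolynomial_le hΦ hs (by linarith : s < ρ / 2) (by linarith : ρ / 2 < ρ) hMX hy 7
  have hq : s / (ρ / 2) = 2 * s / ρ := by
    field_simp
  have hq0 : 0 ≤ 2 * s / ρ := by positivity
  have hMX0 : 0 ≤ MX := (norm_nonneg _).trans (hMX 0 (mem_closedBall_self (by positivity)))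
  rw [hq] at h
  have hpos : 0 < 1 - 2 * s / ρ := by
    have : 2 * s / ρ ≤ 1 / 2 := by rw [div_le_iff₀ hρ]; linarith
    linarith
  have h12 : (1 : ℝ) / 2 ≤ 1 - 2 * s / ρ := by
    have : 2 * s / ρ ≤ 1 / 2 := by rw [div_le_iff₀ hρ]; linarith
    linarith
  have hA : 0 ≤ MX * (2 * s / ρ) ^ 7 := mul_nonneg hMX0 (pow_nonneg hq0 7)
  calc ‖Φ 𝓗 - taylorPolynomial Φ 0 7 𝓗‖ ≤ MX * (2 * s / ρ) ^ 7 / (1 - 2 * s / ρ) := h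
    _ ≤ 2 * MX * (2 * s / ρ) ^ 7 := by
        rw [div_le_iff₀ hpos]
        nlinarith

/-- **(30)** with the printed numbers of **(28)** p. 263 [9]: «The characteristic functions χ₁ defined in (13) give the
restrictions |V(∂p′) − 1| < 2L²g₀p(g₀), hence (28) |B(c)| < 4L²|c₋ − y|g₀p(g₀) < 8L²3R₁M₁r(g₀)g₀p(g₀), and for g₀
sufficiently small the number on the right-hand side above is small. This bound, with a different absolute constant,
extends to the whole configuration B, and this assures that the theorems of [7] are applicable in the present
situation. The bound (28) implies a similar bound for 𝓗(B), with the additional constant B₃ on the right-hand side.»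
With `s = B₃·8L²·3R₁M₁·r(g₀)·g₀·p(g₀)` (`B10.rFun`, `B10.pFun`) the remainder of (30) is
`≤ 2·MX·(48B₃L²R₁M₁/ρ)⁷ · (r(g₀)p(g₀))⁷ · g₀⁷`: the printed `O(g₀⁷)e^{−κ𝓛(X)}` (MX = O(g₀)e^{−κ𝓛(X)} by (25)) with its
constant explicit — it carries `(r(g₀)p(g₀))⁷ = b₀⁷(1 + log g₀⁻¹)^{7(r₀+p₀)}` (growing as g₀ → 0, harmless for the
ε-power counting: `remainder_powerCounting`) and `ρ⁻⁷`, ρ = the analyticity radius of 𝓗 ↦ 𝒫′₁(g₀, X, exp i𝓗) in the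
norm in which (28) is stated (cell GAPS G-B10-04: not printed).  Re-derived arithmetic over `taylor7_remainder_le`.
[cite: Balaban1985UV3, (28)–(30) p.263] -/
theorem remainder30_le {Φ : E → F} {ρ MX : ℝ} (B₃ L R₁ M₁ r₀ b₀ p₀ g₀ : ℝ) (hρ : 0 < ρ)
    (hΦ : DifferentiableOn ℂ Φ (ball 0 ρ)) (hMX : ∀ z ∈ closedBall (0 : E) (ρ / 2), ‖Φ z‖ ≤ MX)
    (hs : 0 < B₃ * (8 * L ^ 2 * 3 * R₁ * M₁ * rFun r₀ g₀ * g₀ * pFun b₀ p₀ g₀))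
    (hsρ : B₃ * (8 * L ^ 2 * 3 * R₁ * M₁ * rFun r₀ g₀ * g₀ * pFun b₀ p₀ g₀) ≤ ρ / 4)
    {𝓗 : E} (h𝓗 : ‖𝓗‖ ≤ B₃ * (8 * L ^ 2 * 3 * R₁ * M₁ * rFun r₀ g₀ * g₀ * pFun b₀ p₀ g₀)) :
    ‖Φ 𝓗 - taylorPolynomial Φ 0 7 𝓗‖ ≤
      2 * MX * (48 * B₃ * L ^ 2 * R₁ * M₁ / ρ) ^ 7 * (rFun r₀ g₀ * pFun b₀ p₀ g₀) ^ 7 * g₀ ^ 7 := by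
  have h := taylor7_remainder_le hρ hΦ hMX hs hsρ h𝓗
  refine h.trans (le_of_eq ?_)
  have : 2 * (B₃ * (8 * L ^ 2 * 3 * R₁ * M₁ * rFun r₀ g₀ * g₀ * pFun b₀ p₀ g₀)) / ρ
      = (48 * B₃ * L ^ 2 * R₁ * M₁ / ρ) * (rFun r₀ g₀ * pFun b₀ p₀ g₀) * g₀ := by ring
  rw [this, mul_pow, mul_pow]
  ring

end TaylorRemainder

/-! ## 2. ε-power counting of the seventh-order remainders, uniformly in k -/

section PowerCounting

/-- The ε-power counting behind p. 262 [8] «the remainder by O(g₀⁷p¹⁸(g₀))|Ω₁| ≤ O(ε^{3+κ₀})|T₁|, κ₀ > 0» and p. 269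
[15] «The remainders for both expressions are estimated by O(g⁷p¹⁸(g_k))|B(Λ_{k+1})| ≤ O((L^kε)^{3+κ₀})|T₁^{(k)}|»
⟦sic: g_k⁷⟧, made quantitative and UNIFORM IN k: with `g_k = g(L^kε)^{1/2}` (`B10.gRun`) and `0 < g_k ≤ 1`, for every
real `q > 0` and every `κ₀ < ½`,
`g_k⁷ (1 + log g_k⁻¹)^q ≤ g^{6+2κ₀} (q/(1−2κ₀))^q e^{(1−2κ₀)−q} · (L^kε)^{3+κ₀}`.
Proof: `g_k⁷ = (L^kε)^{3+κ₀} g^{6+2κ₀} g_k^{1−2κ₀}` and `g_k^{1−2κ₀}(1 + log g_k⁻¹)^q ≤ (q/(1−2κ₀))^q e^{(1−2κ₀)−q}` by the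
tangent-line lemma `B10.rpow_mul_exp_neg_le`.  The constant depends on (g, q, κ₀) only — not on k, ε, L — which is the
uniformity "O(1) independent of ε, k" of Theorem 1 at this step (not displayed in print; cell GAPS C-adv9-29 (d) /
C-adv9-32 (d)); the exponent 3 + κ₀ is available exactly for κ₀ < ½ (g_k⁷ ∼ (L^kε)^{7/2}).  Re-derived, kernel-checked.
[cite: Balaban1985UV3, p.262 + p.269] -/
theorem gRun_pow7_logpow_le (g L ε κ₀ q : ℝ) (k : ℕ) (hg : 0 < g) (hL : 0 < L) (hε : 0 < ε)
    (hκ : κ₀ < 1 / 2) (hq : 0 < q) (hgk : gRun g L ε k ≤ 1) :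
    gRun g L ε k ^ 7 * (1 + Real.log (gRun g L ε k)⁻¹) ^ q ≤
      (g ^ (6 + 2 * κ₀) * ((q / (1 - 2 * κ₀)) ^ q * Real.exp ((1 - 2 * κ₀) - q))) *
        (L ^ k * ε) ^ (3 + κ₀) := by
  set t : ℝ := L ^ k * ε with ht
  have ht0 : 0 < t := by positivity
  have hγ0 : 0 < gRun g L ε k := gRun_pos g L ε hg hL hε k
  set γ : ℝ := gRun g L ε k with hγ
  set u : ℝ := Real.log γ⁻¹ with hu
  have hu0 : 0 ≤ u := log_inv_nonneg_of_le_one hγ0 hgk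
  have h12 : 0 < 1 - 2 * κ₀ := by linarith
  have hcore := rpow_mul_exp_neg_le q (1 - 2 * κ₀) u hq h12 (by linarith)
  -- γ = e^{-u}
  have hγexp : γ = Real.exp (-u) := by
    rw [hu, Real.log_inv, neg_neg, Real.exp_log hγ0]
  -- t = γ² / g²
  have htγ : t = γ ^ 2 / g ^ 2 := by
    have h1 : γ = g * Real.sqrt t := by rw [hγ]; rfl
    have h2 : γ ^ 2 = g ^ 2 * t := by
      rw [h1, mul_pow, Real.sq_sqrt ht0.le]
    rw [h2]
    field_simp
  -- γ⁷ split
  have hγ7 : γ ^ 7 = Real.exp (-((6 + 2 * κ₀) * u)) * Real.exp (-((1 - 2 * κ₀) * u)) := by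
    rw [hγexp, ← Real.exp_nat_mul, ← Real.exp_add]
    congr 1
    push_cast
    ring
  -- t^{3+κ₀} in terms of u
  have htpow : t ^ (3 + κ₀) = Real.exp (-((6 + 2 * κ₀) * u)) / g ^ (6 + 2 * κ₀) := by
    have h3 : t = Real.exp (-(2 * u)) / g ^ (2 : ℝ) := by
      rw [htγ, hγexp, ← Real.exp_nat_mul, Real.rpow_two]
      congr 2
      push_cast
      ring
    rw [h3, Real.div_rpow (Real.exp_nonneg _) (Real.rpow_nonneg hg.le _), ← Real.exp_mul,
      ← Real.rpow_mul hg.le]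
    congr 2
    · ring
    · ring
  have hgpow : 0 < g ^ (6 + 2 * κ₀) := Real.rpow_pos_of_pos hg _
  calc γ ^ 7 * (1 + u) ^ q
      = Real.exp (-((6 + 2 * κ₀) * u)) * ((1 + u) ^ q * Real.exp (-((1 - 2 * κ₀) * u))) := by
        rw [hγ7]; ring
    _ ≤ Real.exp (-((6 + 2 * κ₀) * u)) * ((q / (1 - 2 * κ₀)) ^ q * Real.exp ((1 - 2 * κ₀) - q)) :=
        mul_le_mul_of_nonneg_left hcore (Real.exp_nonneg _)
    _ = (g ^ (6 + 2 * κ₀) * ((q / (1 - 2 * κ₀)) ^ q * Real.exp ((1 - 2 * κ₀) - q))) * t ^ (3 + κ₀) := by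
        rw [htpow]
        field_simp

/-- Elementary: `p(g)ⁿ = b₀ⁿ (1 + log g⁻¹)^{n p₀}` for `0 < g ≤ 1` (`B10.pFun`). [folklore] -/
theorem pFun_pow (b₀ p₀ g : ℝ) (n : ℕ) (hg : 0 < g) (hg1 : g ≤ 1) :
    pFun b₀ p₀ g ^ n = b₀ ^ n * (1 + Real.log g⁻¹) ^ ((n : ℝ) * p₀) := by
  have hu := log_inv_nonneg_of_le_one hg hg1
  unfold pFun
  rw [mul_pow, mul_comm (n : ℝ) p₀, Real.rpow_mul (by linarith), Real.rpow_natCast]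

/-- Elementary: `(r(g)p(g))ⁿ = b₀ⁿ (1 + log g⁻¹)^{n (r₀ + p₀)}` for `0 < g ≤ 1` (`B10.rFun`, `B10.pFun`). [folklore] -/
theorem rFun_mul_pFun_pow (r₀ b₀ p₀ g : ℝ) (n : ℕ) (hg : 0 < g) (hg1 : g ≤ 1) :
    (rFun r₀ g * pFun b₀ p₀ g) ^ n = b₀ ^ n * (1 + Real.log g⁻¹) ^ ((n : ℝ) * (r₀ + p₀)) := by
  have hu := log_inv_nonneg_of_le_one hg hg1
  have h1 : (0 : ℝ) < 1 + Real.log g⁻¹ := by linarith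
  unfold rFun pFun
  rw [show (1 + Real.log g⁻¹) ^ r₀ * (b₀ * (1 + Real.log g⁻¹) ^ p₀)
      = b₀ * (1 + Real.log g⁻¹) ^ (r₀ + p₀) by rw [Real.rpow_add h1]; ring, mul_pow,
    mul_comm (n : ℝ) (r₀ + p₀), Real.rpow_mul h1.le, Real.rpow_natCast]

/-- **The printed remainder bounds, quantitatively** (p. 262 [8] «O(g₀⁷p¹⁸(g₀))|Ω₁| ≤ O(ε^{3+κ₀})|T₁|»; p. 269 [15]
«O(g⁷p¹⁸(g_k))|B(Λ_{k+1})| ≤ O((L^kε)^{3+κ₀})|T₁^{(k)}|»; p. 270 [16] «so that the overall factor is (g_kp(g_k))⁷.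
Estimating next in a similar way as in (45), (46) we get O((L^kε)^{3+κ₀})|B(Λ_{k+1})|»): for a remainder
`C·g_k⁷·b₀ᵐ(1 + log g_k⁻¹)^q·vol` (q = 18p₀ for p¹⁸, q = 7(r₀ + p₀) for (r p)⁷ — `pFun_pow`, `rFun_mul_pFun_pow`) on a
region of volume `vol ≤ |T₁^{(k)}|` (|Ω₁|, |B(Λ_{k+1})| ≤ |T₁^{(k)}|), and `0 < κ₀ < ½` ⟦the print only says κ₀ > 0⟧,
`remainder ≤ C·b₀ᵐ·K(g,q,κ₀)·(L^kε)^{3+κ₀}·|T₁^{(k)}|` with `K` of `gRun_pow7_logpow_le`, the same for all k.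
Re-derived, kernel-checked. [cite: Balaban1985UV3, p.262 + p.269–270] -/
theorem remainder_powerCounting (g L ε κ₀ q C b₀ : ℝ) (m : ℕ) (k : ℕ) (vol sites : ℝ)
    (hg : 0 < g) (hL : 0 < L) (hε : 0 < ε) (hκ : κ₀ < 1 / 2) (hq : 0 < q) (hC : 0 ≤ C) (hb : 0 ≤ b₀)
    (hgk : gRun g L ε k ≤ 1) (hvol0 : 0 ≤ vol) (hvol : vol ≤ sites) :
    C * gRun g L ε k ^ 7 * (b₀ ^ m * (1 + Real.log (gRun g L ε k)⁻¹) ^ q) * vol ≤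
      C * b₀ ^ m * (g ^ (6 + 2 * κ₀) * ((q / (1 - 2 * κ₀)) ^ q * Real.exp ((1 - 2 * κ₀) - q))) *
        ((L ^ k * ε) ^ (3 + κ₀) * sites) := by
  have hcore := gRun_pow7_logpow_le g L ε κ₀ q k hg hL hε hκ hq hgk
  have hK : 0 ≤ g ^ (6 + 2 * κ₀) * ((q / (1 - 2 * κ₀)) ^ q * Real.exp ((1 - 2 * κ₀) - q)) := by
    have h12 : 0 < 1 - 2 * κ₀ := by linarith
    positivity
  have ht : 0 ≤ (L ^ k * ε) ^ (3 + κ₀) := Real.rpow_nonneg (by positivity) _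
  have hbm : 0 ≤ C * b₀ ^ m := mul_nonneg hC (pow_nonneg hb m)
  calc C * gRun g L ε k ^ 7 * (b₀ ^ m * (1 + Real.log (gRun g L ε k)⁻¹) ^ q) * vol
      = C * b₀ ^ m * (gRun g L ε k ^ 7 * (1 + Real.log (gRun g L ε k)⁻¹) ^ q) * vol := by ring
    _ ≤ C * b₀ ^ m * (g ^ (6 + 2 * κ₀) * ((q / (1 - 2 * κ₀)) ^ q * Real.exp ((1 - 2 * κ₀) - q)) *
          (L ^ k * ε) ^ (3 + κ₀)) * vol :=
        mul_le_mul_of_nonneg_right (mul_le_mul_of_nonneg_left hcore hbm) hvol0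
    _ ≤ C * b₀ ^ m * (g ^ (6 + 2 * κ₀) * ((q / (1 - 2 * κ₀)) ^ q * Real.exp ((1 - 2 * κ₀) - q)) *
          (L ^ k * ε) ^ (3 + κ₀)) * sites :=
        mul_le_mul_of_nonneg_left hvol (mul_nonneg hbm (mul_nonneg hK ht))
    _ = _ := by ring

end PowerCounting

/-! ## 3. One renormalization step as exponent bookkeeping: the "gathering together" of p. 265 and pp. 271–272 -/

section Gathering

variable {T : TowerRun} {k : ℕ}

/-- The NAMED REAL PIECES of one renormalization step k → k + 1 of [Balaban1985UV3] (k = 0: Sect. A, (22)–(36)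
pp. 261–265 [7–11]; k ≥ 1: Sect. C, (48)–(62) pp. 267–272 [13–18], p. 267: «Now we do the same operations as in the
first step»), per level-(k+1) large-field history `h : T.Hist (k+1)` (= `{Ω_j, Λ_j, Z_j, V_j}_{j ≤ k}` ∪ the new
`Ω_{k+1}`, with `proj h` its level-k part re-used from (41)_k in (49)–(51)) and configuration `U : T.Cfg (k+1)` (= V):
`Zvol h` = |Z_k| («Z_j = Ω_{j+1}^{(j)c}», p. 266, «rescaled to the unit scale»; at k = 0, |Ω₁ᶜ|), zero at the trivial
history (Ω_{k+1} = T_η); `starB h` / `starT` = |B(Λ_{k+1})*| (k = 0: |Ω₁*|) / |T₁^{(k)*}|; `logσ₀`, `dg` = log σ₀, d(𝔤);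
`logZU h U` / `logZ1 h` / `logZT` = log Z^{(k)}(B(Λ_{k+1}), U_{k+1}) / log Z^{(k)}(B(Λ_{k+1}), 1) / log Z^{(k)}(T₁^{(k)}, 1)
(k = 0: Z^{(0)}(Ω₁, U₁), Z^{(0)}(Ω₁, 1), Z^{(0)}(T₁, 1)); `logFl h U` = the logarithm of the fluctuation integral (last
factor of (22); «The integral on the right-hand side of (55)»); `PprU h U` / `Ppr1 h` = Σ_X 𝒫′_{k+1}(g_k, X, U_{k+1}) /
Σ_X 𝒫′_{k+1}(g_k, X, 1) over the localizations of (24)/(59); `PprT` = the whole-lattice vacuum sum Σ_X 𝒫′_{k+1}(g_k, X, 1)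
of E^{(k)} ((36), (62)); `PY h U` / `PYZ h U` = the Σ_{Y_{k+1}} 𝒫_{k+1}(g_k, Y_{k+1}, U_{k+1}) produced by (33)/(60) and by
the decomposition of log Z(·, U_{k+1}) − log Z(·, 1) (p. 265 / (61)); `Pold h U` / `PoldIn h U` = the previous-scale
terms Σ_{j≤k}Σ_{Y_j} 𝒫_j(Y_j, U_{k+1}) of (58), all of them / those with Y_j ⊂ Ω_{k+1} (both 0 at k = 0); `rem` = the
remainder unit (L^kε)^{3+κ₀}|T₁^{(k)}| ≥ 0.  Only NAMES printed quantities; nothing is constructed.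
[cite: Balaban1985UV3, (22)–(36) pp.261–265 + (55)–(62) pp.269–272] -/
structure StepPieces (T : TowerRun) (k : ℕ) where
  proj : T.Hist (k + 1) → T.Hist k
  proj_triv : proj (T.triv (k + 1)) = T.triv k
  Zvol : T.Hist (k + 1) → ℝ
  Zvol_nonneg : ∀ h, 0 ≤ Zvol h
  Zvol_triv : Zvol (T.triv (k + 1)) = 0
  starB : T.Hist (k + 1) → ℝ
  starT : ℝ
  logσ₀ : ℝ
  dg : ℝ
  dg_nonneg : 0 ≤ dg
  logZU : T.Hist (k + 1) → T.Cfg (k + 1) → ℝ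
  logZ1 : T.Hist (k + 1) → ℝ
  logZT : ℝ
  logFl : T.Hist (k + 1) → T.Cfg (k + 1) → ℝ
  PprU : T.Hist (k + 1) → T.Cfg (k + 1) → ℝ
  Ppr1 : T.Hist (k + 1) → ℝ
  PprT : ℝ
  PY : T.Hist (k + 1) → T.Cfg (k + 1) → ℝ
  PYZ : T.Hist (k + 1) → T.Cfg (k + 1) → ℝ
  Pold : T.Hist (k + 1) → T.Cfg (k + 1) → ℝ
  PoldIn : T.Hist (k + 1) → T.Cfg (k + 1) → ℝ
  rem : ℝ
  rem_nonneg : 0 ≤ rem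

/-- LEAF (upper bound, per history).  k = 0: **(22)** p. 261 [7] «Finally we make the transformation A → g₀A in (18).
Taking into account this transformation and the formulas (19)–(21), we obtain (22) (Tρ₀)(V) ≤ Σ_{Ω₁} χ₁ ∫dV₀↾_{Ω₁ᶜ}
Π_{b′⊂Ω₁ᶜ} δ(V̄₀(b′)V⁻¹(b′)) ζ_{Ω₁ᶜ} … = Σ_{Ω₁} χ₁ ∫dV₀↾_{Ω₁ᶜ} Π_{b′⊂Ω₁ᶜ} δ(V̄₀(b′)V⁻¹(b′)) ζ_{Ω₁ᶜ} exp[−(1/g₀²)A(U₁)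
+ log Z^{(0)}(Ω₁, U₁) − E + log σ₀|Ω₁*| + d(𝔤) log g₀|Ω₁*|] × ∫dμ_{C^{(0)}(Ω₁,U₁)}(A)χ exp[v(g₀A) − (1/g₀²)Ṽ(g₀A)]»
(E = E₀ = `T.Ecst 0`; the outer sum/integral with χ₁ζ is `T.LF 1 U`; −(1/g₀²)A(U₁) = −(1/g₁²)A^{L⁻¹}(U₁) of (36) «where
g₁ = g(Lε)^{1/2}» — the d = 3 scaling A^{L⁻¹}= L·A, g₁² = Lg₀² — is `−T.mainT 1 h U`).  k ≥ 1: **(55)** p. 269 [15]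
«(The integral (49)) ≤ χ_{k+1} exp[−(1/g_k²)A^η(U_{k+1}) − E_k + log σ₀|B(Λ_{k+1})*| + d(𝔤) log g_k|B(Λ_{k+1})*| +
log Z^{(k)}(B(Λ_{k+1}), U_{k+1})] × ∫dμ_{C^{(k)}(B(Λ_{k+1}),U_{k+1})}(A) χ exp[v(g_kA) − (1/g_k²)Ṽ(g_kA) + Σ_{j=1}^k Σ_{Y_j}
𝒫_j(Y_j, exp iη𝓗(g_kA − D̃(g_kA))U_{k+1}) + (the constants in (41))]» with **(58)** p. 270 [16] «The integral on the
right-hand side of (55) is estimated by (58) exp[Σ_{j=1}^k Σ_{Y_j} 𝒫_j(Y_j, U_{k+1}) + (the constants in (41))] ×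
∫dμ_{C^{(k)}}(A)χ exp[𝒱(A) + O((L^kε)^{3+κ₀})|T₁^{(k)}|]», reached from (41)_k through p. 267 «We apply the renormalization
transformation T to the density ρ_k, and we use the inductive inequality (41)» and (48)–(54) ((the constants in (41))
= `T.Zterm k (proj h) + T.Rm k`; the O((L^kε)^{3+κ₀})|T₁^{(k)}| of (58) is inside `logFl`).  Printed proof: (8)–(21)
resp. (48)–(54), (56)–(57); located census (cell GAPS): (22)'s undefined Ṽ, Z^{(0)}, C^{(0)} (G-B10-03), the composite
minimizer (G-B10-08, G-B10-11), the extension of (44) (G-B10-05), the degree floor of (56) (G-adv9-30).  A leaf, not a claim.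
[cite: Balaban1985UV3, (22) p.261 + (55) p.269 + (58) p.270] -/
def Bound55 (P : StepPieces T k) : Prop :=
  Ineq41 T k → ∀ U : T.Cfg (k + 1), T.ρ (k + 1) U ≤
    T.LF (k + 1) U (fun h => -(T.mainT (k + 1) h U) - T.Ecst k
      + (P.logσ₀ + P.dg * Real.log (T.g k)) * P.starB h + P.logZU h U + P.Pold h U
      + T.Zterm k (P.proj h) + T.Rm k + P.logFl h U)

/-- LEAF (lower bound, trivial history).  k = 0: p. 265 [11] «Let us make a remark about a lower bound. We introduce
restrictions on fields in a slightly different way. The characteristic function χ₁ denotes restrictions on V of the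
form |U₁(∂p) − 1| < L⁻²g₀p(g₁), where U₁ = U₁(V) is the minimal configuration determined by V. The restrictions on A
are introduced as in (18), and we perform the same operations on the whole lattice as on the sets Ω₁.» — i.e. (22) as a
LOWER bound at Ω₁ = T₁ (no large fields, no V₀-integration: the trivial history `T.triv 1`, characteristic function
`T.χ 1`).  k ≥ 1: p. 272 [18] «The lower bound is proved in the same way, with all simplifications coming from the fact
that Ω_{k+1} = T_η.» with (47)_k as input.  One printed sentence each (cell census S-C6); a leaf, not a claim.
[cite: Balaban1985UV3, p.265 + p.272] -/
def Bound55Lower (P : StepPieces T k) : Prop :=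
  Ineq47 T k → ∀ U : T.Cfg (k + 1),
    T.χ (k + 1) U * Real.exp (-(T.mainT (k + 1) (T.triv (k + 1)) U) - T.Ecst k
      + (P.logσ₀ + P.dg * Real.log (T.g k)) * P.starB (T.triv (k + 1)) + P.logZU (T.triv (k + 1)) U
      + P.Pold (T.triv (k + 1)) U - T.Rm k + P.logFl (T.triv (k + 1)) U) ≤ T.ρ (k + 1) U

/-- LEAF.  k = 0: **(24)** p. 262 [8] «Summing the expressions with the same localization X we get finally the inequality
(24) ∫dμ_{C^{(0)}(Ω₁,U₁)}(A)χ exp[v(g₀A) − (1/g₀²)Ṽ(g₀A)] ≤ exp[Σ_X 𝒫′₁(g₀, X, U₁) + O(ε^{3+κ₀})|T₁|], where the sum is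
over localizations X which have diameter smaller than RM₁.» (via p. 261–262 «we expand v(g₀A) − 1/g₀²Ṽ(g₀A) up to the
sixth order (or higher) in g₀, and we estimate the remainder by O(g₀⁷p¹⁸(g₀))|Ω₁| ≤ O(ε^{3+κ₀})|T₁|, κ₀ > 0. Next, the
integral is calculated by the cumulant expansion formula (3.24) [8], again up to the sixth order in g₀.» and (23)).
k ≥ 1: p. 270 [16] «The integral above is calculated by the cumulant expansion up to the sixth order in g_k, the error
being of the order O((L^kε)^{3+κ₀})|T₁^{(k)}|. … We get a sum of terms, each having a localization domain X. Terms with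
localization domains X having non-empty intersections with Ω_{k+1}ᶜ are estimated by O(g_k)|Z_k|. Terms with domains
X, which are not contained in a cube of the size R(g_k)M₁, are estimated by O((L^kε)^{3+κ₀})|T₁^{(k)}|. The remaining
terms give the sum (59) Σ_X 𝒫′_{k+1}(g_k, X, U_{k+1})».  Typed: `logFl ≤ PprU + Cz·g_k·|Z_k| + C·rem` (Cz = 0 at k = 0).
Located census: the cumulant lemma's hypotheses (G-adv5-3), random-walk locality (G-IF-04), the seventh-order
remainders (`remainder30_le`, `remainder_powerCounting` give their calculus; the analyticity inputs are G-B10-04/05).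
[cite: Balaban1985UV3, (24) p.262 + (58)–(59) p.270] -/
def Cumulant58 (P : StepPieces T k) (Cz C : ℝ) : Prop :=
  ∀ (h : T.Hist (k + 1)) (U : T.Cfg (k + 1)),
    P.logFl h U ≤ P.PprU h U + Cz * T.g k * P.Zvol h + C * P.rem

/-- LEAF (lower direction of the cluster expansion at the trivial history, for (37)/(47)): p. 265 [11] «we perform the
same operations on the whole lattice as on the sets Ω₁. They give the inequality (37)»; p. 272 [18] «The lower bound
is proved in the same way».  Typed: `PprU − C·rem ≤ logFl` at `T.triv (k+1)`.  One sentence in print (census S-C6).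
[cite: Balaban1985UV3, (37) p.265 + p.272] -/
def CumulantLower (P : StepPieces T k) (C : ℝ) : Prop :=
  ∀ U : T.Cfg (k + 1), P.PprU (T.triv (k + 1)) U - C * P.rem ≤ P.logFl (T.triv (k + 1)) U

/-- LEAF.  k = 0: **(33)** p. 264 [10] «Thus we obtain the following very simple representation (33) Σ_X 𝒫′₁(g₀, X, U₁) =
Σ_X 𝒫′₁(g₀, X, 1) + Σ_Y 𝒫₁(g₀, Y, U₁) + O(ε^{3+κ₀})|T₁|, where Y = (y, c₁, …, c_n), y represents a big block, i.e. y ∈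
Ω₁ ∩ M₁Z³, c_i are bonds in Ω₁^{(1)}, |c_{i,−} − y| < RM₁, (34) 𝒫₁(g₀, Y, U₁) = ⟨𝒫₁(g₀, Y), B₁(c₁), …, B₁(c_n)⟩, n ≥ 2,
… |𝒫₁(g₀, Y)| ≤ O(g₀) Π_{i=1}^n exp(−κ₁M₁⁻¹|c_{i,−} − y|).» (from (26)–(32): gauge fixing by [7] Sect. F, the expansion (30),
the vanishing (32) of the first-order term).  k ≥ 1: **(60)** p. 271 [17] «Summing up terms with the same monomial in B
yields the following analog of (33), (60) Σ_X 𝒫′_{k+1}(g_k, X, U_{k+1}) = Σ_X 𝒫′_{k+1}(g_k, X, 1) + Σ_{Y_{k+1}}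
𝒫_{k+1}(g_k, Y_{k+1}, U_{k+1}) + O((L^kε)^{3+κ₀})|T₁^{(k)}|».  Typed as a two-sided O-bound.  Located census: (30)'s
radius (G-B10-04, `remainder30_le`), the collar of □₁ (G-adv9-27). [cite: Balaban1985UV3, (33) p.264 + (60) p.271] -/
def Repr33_60 (P : StepPieces T k) (C : ℝ) : Prop :=
  ∀ (h : T.Hist (k + 1)) (U : T.Cfg (k + 1)), |P.PprU h U - (P.Ppr1 h + P.PY h U)| ≤ C * P.rem

/-- LEAF (the whole-lattice vacuum sum).  k = 0: p. 264–265 [10–11] «Let us consider now the first sum on the right-hand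
side of (33). Of course it is a part of the vacuum energy renormalization counterterm. To obtain the whole counterterm
we have to add a sum of the corresponding terms with localizations X satisfying X ∩ Ω₁ᶜ ≠ ∅. This sum can be bounded
by O(g₀)|Ω₁ᶜ|. We may define the counterterm either in the form of the unrestricted sum, or we may perform operations
inverse to those done up to now and to replace the sum by the usual perturbative expression on the whole lattice T₁,
with the background field U₁ replaced by 1.»  k ≥ 1: p. 270 [16] «Terms with localization domains X having non-empty
intersections with Ω_{k+1}ᶜ are estimated by O(g_k)|Z_k|. Terms with domains X, which are not contained in a cube of
the size R(g_k)M₁, are estimated by O((L^kε)^{3+κ₀})|T₁^{(k)}|.»  Typed: `|PprT − Ppr1 h| ≤ Cv·g_k·|Z_k| + C·rem` (the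
`rem` slack covers the large localizations excluded from (24)/(59), p. 262 «O(ε^κ)|T₁|»).
[cite: Balaban1985UV3, p.265 + p.270] -/
def VacuumWhole (P : StepPieces T k) (Cv C : ℝ) : Prop :=
  ∀ h : T.Hist (k + 1), |P.PprT - P.Ppr1 h| ≤ Cv * T.g k * P.Zvol h + C * P.rem

/-- LEAF (decomposition of the normalising log Z).  k = 0: p. 265 [11] «Finally we normalize log Z^{(0)}(Ω₁, U₁)
subtracting and adding the term log Z^{(0)}(Ω₁, 1) … The term log Z^{(0)}(Ω₁, U₁) − log Z^{(0)}(Ω₁, 1) can be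
decomposed in a similar way as the integral in (24), and we get an expression Σ_Y 𝒫₁(Y, U₁) which is identical to the
expression on the right-hand side of (33), only the coefficients do not depend on g₀. This expansion we analyse in the
general case later.»  k ≥ 1: **(61)** p. 271 [17] «we obtain the inductive inequality (41) for k replaced by k + 1, but
with the additional term (61) log Z^{(k)}(B(Λ_{k+1}), U_{k+1}) − log Z^{(k)}(B(Λ_{k+1}), 1). … To complete the proof of
the inductive assumption (41) we have to expand the term (61) analogously to (60).» and p. 272 [18] «Now let us notice
that gathering together the first terms in the expansions (30) we obtain the expansion of (63) for the external field
U_{k+1} = 1. This is cancelled by the second term in (61), and we obtain the desired expansion.»  Typed: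
`|logZU − logZ1 − PYZ| ≤ C·rem`.  Printed proof = (63) and the two paragraphs of pp. 271–272 (sibling module
`…B10LogDet63`: the operator calculus is kernel-checked there; the walk-locality leaf is G-B10-06 / G-IF-10).
[cite: Balaban1985UV3, (35) p.265 + (61) p.271] -/
def Decomp35_61 (P : StepPieces T k) (C : ℝ) : Prop :=
  ∀ (h : T.Hist (k + 1)) (U : T.Cfg (k + 1)), |P.logZU h U - P.logZ1 h - P.PYZ h U| ≤ C * P.rem

/-- LEAF.  k = 0: **(35)** p. 265 [11] «log Z^{(0)}(Ω₁, 1), which we have to supplement to the whole lattice using the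
bound (35) |log (Z^{(0)}(Ω₁, 1)/Z^{(0)}(T₁, 1))| ≤ O(1)|Ω₁ᶜ|.» (asserted, no proof in print).  k ≥ 1: NOT PRINTED — the
analogue `|log Z^{(k)}(B(Λ_{k+1}), 1) − log Z^{(k)}(T₁^{(k)}, 1)| ≤ O(1)|Z_k|` is used silently between (61) and (62)
(E^{(k)} contains log Z^{(k)}(T₁^{(k)}, 1)); cell GAPS G-B10-07 (a).  Typed: `|logZ1 h − logZT| ≤ C·|Z_k|`.
[cite: Balaban1985UV3, (35) p.265] -/
def Norm35 (P : StepPieces T k) (C : ℝ) : Prop :=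
  ∀ h : T.Hist (k + 1), |P.logZ1 h - P.logZT| ≤ C * P.Zvol h

/-- LEAF (UNPRINTED COUNT).  k = 0: p. 265 [11] «We have to supplement also the constants in (22), involving log σ₀ and
log g₀, to the whole lattice.»  k ≥ 1: p. 271 [17] «Complementing the constants in (55) to the full lattice T^{(k)}».
The count the sentence needs and the print omits (cell GAPS G-B10-07 (a), C-adv9-29 (b), C-adv9-32 (a): |Ω₁*| = |Ω₁| −
|Ω₁^{(1)}| − |Ax(Ω₁)|): `0 ≤ |T₁^{(k)*}| − |B(Λ_{k+1})*| ≤ c₁|Z_k|` — the deficit of "starred" bonds is carried by the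
complement and is at most proportional to it.  Typed as that pair of inequalities. [cite: Balaban1985UV3, p.265 + p.271] -/
def StarCount (P : StepPieces T k) (c₁ : ℝ) : Prop :=
  ∀ h : T.Hist (k + 1), 0 ≤ P.starT - P.starB h ∧ P.starT - P.starB h ≤ c₁ * P.Zvol h

/-- LEAF.  k ≥ 1: p. 272 [18] «Thus we have estimated ρ_{k+1} by an expression which is almost equal to the right-hand
side of the inductive assumption (41) for k + 1. To get the exact inequality we estimate a sum of all terms 𝒫_j(Y_j,
U_{k+1}) with localizations Y_j not contained in Ω_{k+1} by O(1)|Λ_k|, or by O(1)|Z_k|.» — typed with the |Z_k| option: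
`|Pold − PoldIn| ≤ C·|Z_k|` (the absorption is unwritten: cell GAPS G-B10-07 (b); by (45)–(46) the dropped terms are even
O(M₁³g²_{k−1}p²(g_{k−1})) per block).  Vacuous at k = 0 (no previous-scale terms). [cite: Balaban1985UV3, p.272] -/
def OldOutside (P : StepPieces T k) (C : ℝ) : Prop :=
  ∀ (h : T.Hist (k + 1)) (U : T.Cfg (k + 1)), |P.Pold h U - P.PoldIn h U| ≤ C * P.Zvol h

/-- LEAF (identification of the interaction sum of (41)_{k+1}).  **(36)** p. 265 [11] / **(41)** p. 266 [12]: the term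
«Σ_Y 𝒫₁(g₀, Y, U₁)» of (36), resp. «Σ_{j=1}^{k} Σ_{Y_j} 𝒫_j(Y_j, U_k)» of (41) at k + 1 (= `T.Pint (k+1) h U`), collects:
the previous-scale terms with Y_j ⊂ Ω_{k+1} (p. 266 [12] «y represents big blocks of Lʲη-lattice, contained in Ω_k»),
the Σ_{Y_{k+1}} of (33)/(60), and the Σ_Y of the log Z decomposition (p. 265: «identical to the expression on the
right-hand side of (33), only the coefficients do not depend on g₀»).  Typed as the equation `Pint (k+1) = PoldIn + PY
+ PYZ`. [cite: Balaban1985UV3, (36) p.265 + (41) p.266] -/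
def PintSucc (P : StepPieces T k) : Prop :=
  ∀ (h : T.Hist (k + 1)) (U : T.Cfg (k + 1)), T.Pint (k + 1) h U = P.PoldIn h U + P.PY h U + P.PYZ h U

/-- LEAF (definition of E^{(k)}).  k = 0: **(36)** p. 265 [11] «where g₁ = g(Lε)^{1/2}, E₁ = E − E^{(0)}, and E^{(0)} =
log σ₀|T₁*| + d(𝔤) log g₀|T₁*| + log Z^{(0)}(T₁, 1) + Σ_X 𝒫′₁(g₀, X, 1).»  k ≥ 1: **(62)** p. 271 [17] «The constant
E_{k+1} is defined as E_{k+1} = E_k − E^{(k)}, where (62) E^{(k)} = log σ₀|T₁^{(k)*}| + d(𝔤) log g_k|T₁^{(k)*}| + log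
Z^{(k)}(T₁^{(k)}, 1) + Σ_X 𝒫′_{k+1}(g_k, X, 1).» (`T.Estep k` = E^{(k)}; E_{k+1} = E_k − E^{(k)} is `T.Ecst_eq`, cf.
`B10.Ek_succ`). [cite: Balaban1985UV3, (36) p.265 + (62) p.271] -/
def Estep62 (P : StepPieces T k) : Prop :=
  T.Estep k = (P.logσ₀ + P.dg * Real.log (T.g k)) * P.starT + P.logZT + P.PprT

/-- LEAF (how large the printed `O(log g_k⁻¹)|Z_k|` of (36)/(41) must be taken): the Z-terms of (41)_{k+1} exceed those of
(41)_k at the projected history by at least `CZ·|Z_k|`; `ineq41_succ_of_leaves` needs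
`CZ = (Cz + Cv)·g_k + C₅ + C₆ + (|log σ₀| + d(𝔤) log g_k⁻¹)·c₁` (Cz, Cv, C₅, C₆, c₁ the constants of `Cumulant58`, `VacuumWhole`, `Norm35`, `OldOutside`, `StarCount`) — O(log g_k⁻¹) as printed ((36) p. 265
«+ O(log g₀⁻¹)|Ω₁ᶜ|»; (41) p. 266 «Σ_{j=0}^{k−1} O(log g_j⁻¹)|Z_j|»), the log coming ONLY from the complemented
`d(𝔤) log g_k|·*|` constant. [cite: Balaban1985UV3, (36) p.265 + (41) p.266] -/
def ZtermSucc (P : StepPieces T k) (CZ : ℝ) : Prop :=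
  ∀ h : T.Hist (k + 1), T.Zterm k (P.proj h) + CZ * P.Zvol h ≤ T.Zterm (k + 1) h

/-- LEAF (how large the printed `O((L^kε)^{3+κ₀})|T₁^{(k)}|` of (36)/(41)/(47) must be taken): `Rm (k+1) ≥ Rm k + CR·rem`
with `CR` the sum of the four remainder constants of `Cumulant58`/`Repr33_60`/`VacuumWhole`/`Decomp35_61` ((36) p. 265
«+ O(ε^{3+κ₀})|T₁|»; (41) p. 266 «Σ_{j=0}^{k−1} O((Lʲε)^{3+κ₀})|T₁^{(j)}|»). [cite: Balaban1985UV3, (36) p.265 + (41) p.266] -/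
def RmSucc (P : StepPieces T k) (CR : ℝ) : Prop :=
  T.Rm k + CR * P.rem ≤ T.Rm (k + 1)

/-- The complement of the constants, kernel-checked: with `0 < g_k ≤ 1` (log g_k ≤ 0), `d(𝔤) ≥ 0` and the count
`StarCount`, `(log σ₀ + d(𝔤) log g_k)|B*| ≤ (log σ₀ + d(𝔤) log g_k)|T*| + (|log σ₀| + d(𝔤) log g_k⁻¹)·c₁|Z_k|` — this is
where the `O(log g_k⁻¹)|Z_k|` of (36)/(41) is born (p. 265 «We have to supplement also the constants in (22), involving
log σ₀ and log g₀, to the whole lattice»).  Re-derived. [cite: Balaban1985UV3, p.265] -/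
theorem constants_complement (P : StepPieces T k) {c₁ : ℝ} (hg : 0 < T.g k) (hg1 : T.g k ≤ 1)
    (hstar : StarCount P c₁) (h : T.Hist (k + 1)) :
    (P.logσ₀ + P.dg * Real.log (T.g k)) * P.starB h ≤
      (P.logσ₀ + P.dg * Real.log (T.g k)) * P.starT
        + (|P.logσ₀| + P.dg * Real.log (T.g k)⁻¹) * (c₁ * P.Zvol h) := by
  obtain ⟨hs0, hs1⟩ := hstar h
  have hlog : Real.log (T.g k) ≤ 0 := Real.log_nonpos hg.le hg1
  have hli : Real.log (T.g k)⁻¹ = -Real.log (T.g k) := Real.log_inv _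
  rw [hli]
  have hD1 : -P.logσ₀ * (P.starT - P.starB h) ≤ |P.logσ₀| * (P.starT - P.starB h) :=
    mul_le_mul_of_nonneg_right (neg_le_abs _) hs0
  have hnn : 0 ≤ |P.logσ₀| + P.dg * -Real.log (T.g k) :=
    add_nonneg (abs_nonneg _) (mul_nonneg P.dg_nonneg (by linarith))
  have hD2 : (|P.logσ₀| + P.dg * -Real.log (T.g k)) * (P.starT - P.starB h) ≤
      (|P.logσ₀| + P.dg * -Real.log (T.g k)) * (c₁ * P.Zvol h) :=
    mul_le_mul_of_nonneg_left hs1 hnn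
  have hD3 : 0 ≤ P.dg * -Real.log (T.g k) * (P.starT - P.starB h) :=
    mul_nonneg (mul_nonneg P.dg_nonneg (by linarith)) hs0
  nlinarith [hD1, hD2, hD3]

/-- **«Gathering together the inequalities and transformations we obtain finally (36)»** (p. 265 [11]) and
**«Complementing the constants in (55) to the full lattice T^{(k)}, and gathering together all the transformations and
estimates, we obtain the inductive inequality (41) for k replaced by k + 1»** (p. 271 [17]) with p. 272 [18] «To get the
exact inequality we estimate a sum of all terms 𝒫_j(Y_j, U_{k+1}) with localizations Y_j not contained in Ω_{k+1} by
O(1)|Λ_k|, or by O(1)|Z_k|» — RE-DERIVED as exponent bookkeeping: the leaves `Bound55`, `Cumulant58`, `Repr33_60`,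
`VacuumWhole`, `Decomp35_61`, `Norm35`, `StarCount`, `OldOutside`, `PintSucc`, `Estep62` at step k, with `0 < g_k ≤ 1`
and `k + 1 ≤ K`, give `(41)_k → (41)_{k+1}` over the carrier `B10.TowerRun` PROVIDED the Z-term and remainder constants
of (41)_{k+1} are at least the gathered ones (`ZtermSucc`, `RmSucc` with the displayed constants).  Uses only the
monotonicity `T.lf_mono` of the history functional, `T.Ecst_eq` (E_{k+1} = E_k − E^{(k)}) and real arithmetic; no
content of the series. [cite: Balaban1985UV3, (36) p.265 + (41) p.271] -/
theorem ineq41_succ_of_leaves (P : StepPieces T k) {Cz C₁ C₂ Cv C₃ C₄ C₅ c₁ C₆ : ℝ}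
    (hk : k + 1 ≤ T.K) (hg : 0 < T.g k) (hg1 : T.g k ≤ 1)
    (h55 : Bound55 P) (h58 : Cumulant58 P Cz C₁) (h60 : Repr33_60 P C₂) (hvac : VacuumWhole P Cv C₃)
    (h61 : Decomp35_61 P C₄) (h35 : Norm35 P C₅) (hstar : StarCount P c₁) (hold : OldOutside P C₆)
    (hPint : PintSucc P) (hE : Estep62 P)
    (hZ : ZtermSucc P ((Cz + Cv) * T.g k + C₅ + C₆ + (|P.logσ₀| + P.dg * Real.log (T.g k)⁻¹) * c₁))
    (hR : RmSucc P (C₁ + C₂ + C₃ + C₄)) :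
    Ineq41 T k → Ineq41 T (k + 1) := by
  intro h41 U
  refine (h55 h41 U).trans (T.lf_mono (k + 1) U _ _ fun h => ?_)
  have hEcst : T.Ecst (k + 1) = T.Ecst k - T.Estep k := by
    rw [T.Ecst_eq, T.Ecst_eq, Finset.sum_eq_sum_Ico_succ_bot (by omega : k < T.K)]
    ring
  have hconst := constants_complement P hg hg1 hstar h
  have h58' := h58 h U
  have h60' := abs_le.1 (h60 h U)
  have hvac' := abs_le.1 (hvac h)
  have h61' := abs_le.1 (h61 h U)
  have h35' := abs_le.1 (h35 h)
  have hold' := abs_le.1 (hold h U)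
  have hZ' := hZ h
  have hR' : T.Rm k + (C₁ + C₂ + C₃ + C₄) * P.rem ≤ T.Rm (k + 1) := hR
  rw [hPint h U, hEcst, hE]
  nlinarith [h58', h60'.1, h60'.2, hvac'.1, hvac'.2, h61'.1, h61'.2, h35'.1, h35'.2, hold'.1, hold'.2,
    hZ', hR', hconst]

/-- **(37)** p. 265 [11] «They give the inequality (37) ρ₁(V) ≥ χ₁ exp[−(1/g₁²)A^{L⁻¹}(U₁) + Σ_Y 𝒫₁(g₀, Y, U₁) − E₁ −
O(ε^{3+κ₀})|T₁|].» and p. 272 [18] «The lower bound is proved in the same way, with all simplifications coming from the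
fact that Ω_{k+1} = T_η.» — RE-DERIVED as exponent bookkeeping at the trivial history (|Z_k| = 0, so the vacuum,
normalisation and star-count leaves collapse to equalities up to `rem`): the lower leaves `Bound55Lower`,
`CumulantLower` with the two-sided `Repr33_60`, `VacuumWhole`, `Decomp35_61`, `Norm35`, `StarCount`, `OldOutside`,
`PintSucc`, `Estep62` give `(47)_k → (47)_{k+1}` provided `RmSucc` with the four remainder constants.  Uses χ ≥ 0
(`T.χ_nonneg`), monotonicity of exp, `T.Ecst_eq`. [cite: Balaban1985UV3, (37) p.265 + (47) p.272] -/
theorem ineq47_succ_of_leaves (P : StepPieces T k) {C₁ C₂ Cv C₃ C₄ C₅ c₁ C₆ : ℝ}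
    (hk : k + 1 ≤ T.K)
    (h55 : Bound55Lower P) (h58 : CumulantLower P C₁) (h60 : Repr33_60 P C₂) (hvac : VacuumWhole P Cv C₃)
    (h61 : Decomp35_61 P C₄) (h35 : Norm35 P C₅) (hstar : StarCount P c₁) (hold : OldOutside P C₆)
    (hPint : PintSucc P) (hE : Estep62 P) (hR : RmSucc P (C₁ + C₂ + C₃ + C₄)) :
    Ineq47 T k → Ineq47 T (k + 1) := by
  intro h47 U
  refine le_trans ?_ (h55 h47 U)
  apply mul_le_mul_of_nonneg_left _ (T.χ_nonneg (k + 1) U)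
  apply Real.exp_le_exp.mpr
  have hEcst : T.Ecst (k + 1) = T.Ecst k - T.Estep k := by
    rw [T.Ecst_eq, T.Ecst_eq, Finset.sum_eq_sum_Ico_succ_bot (by omega : k < T.K)]
    ring
  have hZ0 : P.Zvol (T.triv (k + 1)) = 0 := P.Zvol_triv
  have h58' := h58 U
  have h60' := abs_le.1 (h60 (T.triv (k + 1)) U)
  have hvac' := abs_le.1 (hvac (T.triv (k + 1)))
  have h61' := abs_le.1 (h61 (T.triv (k + 1)) U)
  have h35' := abs_le.1 (h35 (T.triv (k + 1)))
  have hold' := abs_le.1 (hold (T.triv (k + 1)) U)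
  obtain ⟨hs0, hs1⟩ := hstar (T.triv (k + 1))
  have hR' : T.Rm k + (C₁ + C₂ + C₃ + C₄) * P.rem ≤ T.Rm (k + 1) := hR
  rw [hZ0] at hvac' h35' hold' hs1
  rw [hPint (T.triv (k + 1)) U, hEcst, hE]
  have hstarEq : P.starB (T.triv (k + 1)) = P.starT := by
    have : P.starT - P.starB (T.triv (k + 1)) ≤ 0 := by simpa using hs1
    linarith
  rw [hstarEq]
  nlinarith [h58', h60'.1, h60'.2, hvac'.1, hvac'.2, h61'.1, h61'.2, h35'.1, h35'.2, hold'.1, hold'.2, hR']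

/-- All leaves of ONE step k → k + 1 with their constants, bundled (the data a HistModel-type instantiation would have
to supply; cf. cell GAPS G-B10-10 for the large-field side). [cite: Balaban1985UV3, Sect. A + Sect. C] -/
structure StepLeaves (T : TowerRun) (k : ℕ) where
  P : StepPieces T k
  Cz : ℝ
  C₁ : ℝ
  C₁' : ℝ
  C₂ : ℝ
  Cv : ℝ
  C₃ : ℝ
  C₄ : ℝ
  C₅ : ℝ
  c₁ : ℝ
  C₆ : ℝ
  bound55 : Bound55 P
  bound55Lower : Bound55Lower P
  cumulant58 : Cumulant58 P Cz C₁
  cumulantLower : CumulantLower P C₁'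
  repr33_60 : Repr33_60 P C₂
  vacuumWhole : VacuumWhole P Cv C₃
  decomp35_61 : Decomp35_61 P C₄
  norm35 : Norm35 P C₅
  starCount : StarCount P c₁
  oldOutside : OldOutside P C₆
  pintSucc : PintSucc P
  estep62 : Estep62 P
  ztermSucc : ZtermSucc P ((Cz + Cv) * T.g k + C₅ + C₆ + (|P.logσ₀| + P.dg * Real.log (T.g k)⁻¹) * c₁)
  rmSucc : RmSucc P (max C₁ C₁' + C₂ + C₃ + C₄)

/-- Monotonicity in the remainder constant: `RmSucc P CR → CR' ≤ CR → RmSucc P CR'` (rem ≥ 0). [folklore] -/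
theorem RmSucc.mono {P : StepPieces T k} {CR CR' : ℝ} (h : RmSucc P CR) (hle : CR' ≤ CR) : RmSucc P CR' := by
  unfold RmSucc at *
  nlinarith [P.rem_nonneg, h, hle]

/-- One step, both bounds: the bundled leaves at step k with `0 < g_k ≤ 1`, `k + 1 ≤ K` give
`(41)_k ∧ (47)_k → (41)_{k+1} ∧ (47)_{k+1}`.  Re-derived bookkeeping (`ineq41_succ_of_leaves` + `ineq47_succ_of_leaves`).
[cite: Balaban1985UV3, (36)–(37) p.265 + (41), (47) pp.271–272] -/
theorem step_of_leaves (S : StepLeaves T k) (hk : k + 1 ≤ T.K) (hg : 0 < T.g k) (hg1 : T.g k ≤ 1) :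
    (Ineq41 T k ∧ Ineq47 T k) → (Ineq41 T (k + 1) ∧ Ineq47 T (k + 1)) := by
  rintro ⟨h41, h47⟩
  refine ⟨ineq41_succ_of_leaves S.P hk hg hg1 S.bound55 S.cumulant58 S.repr33_60 S.vacuumWhole S.decomp35_61
      S.norm35 S.starCount S.oldOutside S.pintSucc S.estep62 S.ztermSucc
      (S.rmSucc.mono (by have := le_max_left S.C₁ S.C₁'; linarith)) h41,
    ineq47_succ_of_leaves S.P hk S.bound55Lower S.cumulantLower S.repr33_60 S.vacuumWhole S.decomp35_61
      S.norm35 S.starCount S.oldOutside S.pintSucc S.estep62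
      (S.rmSucc.mono (by have := le_max_right S.C₁ S.C₁'; linarith)) h47⟩

/-- **Sect. A resolved one level down**: the step-0 leaves ((22), (24), (33), (35), p. 265) together with (1) at k = 0
(`B10.Step0Printed`: (41)₀ ∧ (47)₀) give `B10.FirstStep36_37Printed` = (36) ∧ (37).  Re-derived bookkeeping.
[cite: Balaban1985UV3, (36)–(37) p.265] -/
theorem firstStep36_37_of_leaves (T : TowerRun) (h0 : Step0Printed T) (hg : 0 < T.g 0) (hg1 : T.g 0 ≤ 1)
    (S : 1 ≤ T.K → StepLeaves T 0) : FirstStep36_37Printed T := by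
  intro hK
  exact step_of_leaves (S hK) hK hg hg1 h0

/-- **Sect. C resolved one level down**: the step-k leaves ((55), (58)–(62), p. 272) for every 1 ≤ k < K give
`B10.SectCStepPrinted`.  Re-derived bookkeeping. [cite: Balaban1985UV3, Sect. C pp.267–272] -/
theorem sectCStep_of_leaves (T : TowerRun) (hg : ∀ k, k + 1 ≤ T.K → 0 < T.g k ∧ T.g k ≤ 1)
    (S : ∀ k, 1 ≤ k → k + 1 ≤ T.K → StepLeaves T k) : SectCStepPrinted T := by
  intro k hk1 hkK hind
  exact step_of_leaves (S k hk1 hkK) hkK (hg k hkK).1 (hg k hkK).2 hind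

/-- **Theorem 2 from the displayed formulas**: (1) at k = 0 and the step leaves for every k < K give (41) ∧ (47) for all
k ≤ K (`B10.ineqs_of_sections`), and for a family of runs `B10.Thm2Printed` (`B10.thm2_of_sections`).  Re-derived
bookkeeping; every leaf remains a hypothesis. [cite: Balaban1985UV3, Thm 2 p.272] -/
theorem thm2_of_leaves {I : Type} (T : I → TowerRun) (hspec : ∀ i, SpecOK (T i))
    (h0 : ∀ i, Step0Printed (T i)) (hg : ∀ i k, k + 1 ≤ (T i).K → 0 < (T i).g k ∧ (T i).g k ≤ 1)
    (S : ∀ i k, k + 1 ≤ (T i).K → StepLeaves (T i) k) :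
    Thm2Printed (fun i => (T i).toRunData) :=
  thm2_of_sections T hspec h0
    (fun i hK => step_of_leaves (S i 0 hK) hK (hg i 0 hK).1 (hg i 0 hK).2 (h0 i))
    (fun i => sectCStep_of_leaves (T i) (hg i) (fun k _ hkK => S i k hkK))

end Gathering

end Literature.MathematicalPhysics.QuantumFieldTheory.Balaban1983to89.B10SectAGathering
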